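import Literature.NumberTheory.Automorphic.RankinSelbergTorusPositivity
import Literature.NumberTheory.Automorphic.CuspidalTestVector
import Literature.NumberTheory.Automorphic.SmoothedCuspFormGeneric
import Literature.NumberTheory.Automorphic.WhittakerCoeffCentral
import Literature.NumberTheory.Automorphic.SiegelSetVolume
import HarnessLib

/-!
# Jacquet–Shalika's (5.3.3)–(5.3.4) from the finiteness of the unfolded Rankin–Selberg integral

Topic `NumberTheory/Automorphic`; namespace `Literature.NumberTheory.Automorphic`. Assembly file
(theorems only: no definition, no named fact) of the real-point
Rankin–Selberg route to the named fact `JacquetShalika1981_schurSelfSum_prod_bounded`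
(`JacquetShalikaSchurSelfSum`; Jacquet–Shalika, *On Euler products and the classification of
automorphic representations I*, Amer. J. Math. **103** (1981), §4 + §2, Thm. (5.3), (5.3.3)–(5.3.4)),
through which `multipliable_partialStandardL`, `StandardLFunctionData.multipliable_L`,
`summable_normSq_trace_largeFinset` and Lemma (5.2) (`JacquetShalika1981_continuation_partialPairL_conj`)
are reached in the tree.

**What is proved.** `JacquetShalika1981_schurSelfSum_prod_bounded_of_rankinSelbergTorusIntegral_ne_top`:
for `1 ≤ n`, measures `νA` on the torus `(𝔸_Kˣ)ⁿ` (left invariant, s-finite, positive on opens),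
`νK` on `K = K_∞ GL_n(𝒪̂_K)` (s-finite, positive on opens) and a Haar measure `ν₀` on `N_n(𝔸_K)`, and a
continuous positive archimedean test function `Φ_∞`, **if** for every test function `η`, every
`f ∈ L²_cusp` and every real `σ > 1` the unfolded integral
`Ψ(σ) = rankinSelbergTorusIntegral νA νK W_φ (Φ_∞ ⊗ 𝟙_{𝒪̂ⁿ}) σ` of the Whittaker coefficient
`W_φ = whittakerCoeff ν₀ 𝓕_N ψ φ` of `φ = invQuot (S_η f)` (Tate's box and character) is finite, **then**
`JacquetShalika1981_schurSelfSum_prod_bounded` holds. The hypothesis is the upper half of the method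
(the unfolding inequality `Ψ(σ) ≤ ∫ |φ|² E(·, Φ, σ)` over the Whittaker tower, `WhittakerTowerChain`,
and the finiteness of the right-hand side, `RankinSelbergSiegelFiniteness` with the rapid decay of
`GLnCuspidalSiegelDecay`); everything else is assembled here from proved bricks:

1. in `Π` pick `f`, a test function `η ≥ 0` with `S_η f ≠ 0` and its level `𝔫₀`
   (`CuspidalAutomorphicRepGL.exists_isTestFunctionGL_smoothedForm_ne_zero`, `CuspidalTestVector`);
2. `W_φ` is continuous (`continuous_whittakerCoeff`), `N_n(𝔸_K)`-equivariant
   (`whittakerCoeff_unipotent_mul`) and not identically zero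
   (`exists_whittakerCoeff_invQuot_smoothedForm_ne_zero_of_one_le`, `SmoothedCuspFormGeneric`), whence a
   torus base point `diag(a₁) k₀` with `W_φ ≠ 0` (`exists_torusPoint_apply_ne_zero`), moved by a
   rational central scalar (`whittakerCoeff_glDiagonal_const_mul`,
   `exists_ne_zero_valued_algebraMap_mul_le_one`) to `a₀` with integral last entry;
3. the exceptional set `S₀ = supp 𝔫₀ ∪ S_ψ ∪ {w : a₀ not a unit at w}`
   (`exists_finset_adicComponent_adeleAddChar_unramified`, `finite_setOf_exists_valued_ne_one`);
4. for `S ⊇ S₀`, a Satake family `α` of `Π` off `S` enumerated by `x`, and `σ > 1`: positivity of the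
   unit-box integral (`setLIntegral_torusIntegrand_unitBox_ne_zero`, `RankinSelbergTorusPositivity`),
   the hypothesis, and the Euler lower bound `exists_prod_schurSelfSum_le_of_cuspidal`
   (`RankinSelbergTorusIntegral`) bound the partial products `∏_{v ∈ F} T_v(q_v^{-σ})` off `S`.

## References

* H. Jacquet, J. A. Shalika, *On Euler products and the classification of automorphic
  representations I*, Amer. J. Math. 103 (1981), 499–558: §2, §4, Lemma (5.2), Thm. (5.3),
  (5.3.3)–(5.3.4) [JacquetShalikaAJM1981].
* J. W. Cogdell, *Analytic theory of L-functions for GL_n*, in *An Introduction to the Langlands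
  Program* (2004), §2.3, §3 [CogdellAnalyticTheory2004].
-/

noncomputable section

open MeasureTheory Measure NumberField IsDedekindDomain Matrix Set Filter Finset
open scoped MatrixGroups ENNReal NNReal Pointwise Topology ValuativeRel
open Literature.RingTheory.SymmetricFunctions.SymmPoly
open Literature.NumberTheory.GaloisRepresentations (ideleGroup)

namespace Literature.NumberTheory.Automorphic

section Assembly

variable (n : ℕ) (K : Type) [Field K] [NumberField K]

-- Borel structures: the tree's `adelicBorel n K` on `(AdelicGroupData.gl n K).Adelic` (the spelling
-- of `RankinSelbergTorusIntegral`, for `K` and the torus integrand) and `glAdeleBorel n K` of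
-- `SiegelSetVolume` on the definitionally equal `GL (Fin n) (AdeleRing (𝓞 K) K)` (the spelling of the
-- Whittaker tower files, for `N_n(𝔸_K)` and genericity); both are `borel _`, nothing in Mathlib is
-- overridden.
attribute [local instance] adelicBorel borelSpace_adelic locallyCompactSpace_adelic
  secondCountableTopology_gl_adelic glAdeleBorel borelSpace_glAdele

variable {n K}
variable {μ : Measure (AdelicGroupData.gl n K).automorphicQuotient}
  [(AdelicGroupData.gl n K).IsAutomorphicMeasure μ]

/-- **Jacquet–Shalika's bound on the unramified Rankin–Selberg torus sums from the finiteness of the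
unfolded integral** (the named fact `JacquetShalika1981_schurSelfSum_prod_bounded`, i.e. (5.3.3)–(5.3.4)
of Jacquet–Shalika (1981) off large finite sets, for `GL_n`, `1 ≤ n`): if for every test function
`η`, every `f ∈ L²_cusp` and every `σ > 1` the unfolded Rankin–Selberg integral of the Whittaker
coefficient of `invQuot (S_η f)` against `Φ_∞ ⊗ 𝟙_{𝒪̂ⁿ}` is finite, then for every cuspidal `Π` there is
a finite `S₀` such that for all finite `S ⊇ S₀`, all Satake families of `Π` off `S`, all
enumerations and all `σ > 1` the partial products of the torus sums `T_v(q_v^{-σ})` off `S` are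
bounded. See the module docstring for the assembly.
[cite: JacquetShalikaAJM1981, Thm. (5.3), proof, (5.3.3)–(5.3.4); §4; §2 Prop. (2.3)] -/
theorem JacquetShalika1981_schurSelfSum_prod_bounded_of_rankinSelbergTorusIntegral_ne_top
    (hn : 1 ≤ n) [MeasurableSpace (ideleGroup K)] [BorelSpace (ideleGroup K)]
    (νA : Measure (Fin n → ideleGroup K)) [νA.IsMulLeftInvariant] [SFinite νA] [νA.IsOpenPosMeasure]
    (νK : Measure ↥(maximalCompactAdelic n K)) [SFinite νK] [νK.IsOpenPosMeasure]
    (ν₀ : Measure ↥(adelicUnipotent n K)) [IsHaarMeasure ν₀]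
    {Φinf : (Fin n → InfiniteAdeleRing K) → ℝ} (hΦc : Continuous Φinf) (hΦ : ∀ z, 0 < Φinf z)
    (hfin : ∀ (η : (AdelicGroupData.gl n K).Adelic → ℝ), IsTestFunctionGL n K η →
      ∀ (f : (AdelicGroupData.gl n K).L2 μ), f ∈ cuspidalSubspace n K μ → ∀ ⦃σ : ℝ⦄, 1 < σ →
        rankinSelbergTorusIntegral n K νA νK
          (whittakerCoeff ν₀ (unipotentTateDomain n K) (adeleAddChar K)
            (invQuot (AdelicGroupData.gl n K) (smoothedForm η f)))
          (standardTestFun n K Φinf) σ ≠ ⊤) :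
    JacquetShalika1981_schurSelfSum_prod_bounded (μ := μ) := by
  intro P
  classical
  -- topological and measurable structures
  haveI : T2Space (GL (Fin n) (AdeleRing (𝓞 K) K)) := t2Space_gl n K
  haveI : LocallyCompactSpace (GL (Fin n) (AdeleRing (𝓞 K) K)) :=
    AdelicGroupData.locallyCompactSpace_generalLinearGroup_adeleRing K (Fin n)
  haveI := secondCountableTopology_generalLinearGroup_adeleRing K (Fin n)
  haveI : T2Space (AdeleRing (𝓞 K) K) := t2Space_adeleRing K
  letI : MeasurableSpace (AdeleRing (𝓞 K) K) := borel _
  haveI : BorelSpace (AdeleRing (𝓞 K) K) := ⟨rfl⟩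
  haveI hν₀R : ν₀.IsMulRightInvariant := isMulRightInvariant_of_isHaarMeasure_adelicUnipotent ν₀
  -- (1) the test vector with a level
  obtain ⟨f, η, hη, -, hne, 𝔫₀, h𝔫₀, hηK⟩ := P.exists_isTestFunctionGL_smoothedForm_ne_zero
  have hηc : Continuous η := hη.continuous
  have hηs : HasCompactSupport η := hη.hasCompactSupport
  have hcusp : ((f : P.1.toSubmodule) : (AdelicGroupData.gl n K).L2 μ) ∈ cuspidalSubspace n K μ :=
    P.le_cuspidalSubspace f.2
  -- (2) the Whittaker coefficient: continuity, equivariance, genericity, base point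
  have hψ : IsGlobalAddChar K (adeleAddChar K) := isGlobalAddChar_adeleAddChar (K := K)
  have h𝓕 : IsFundamentalDomain ↥(rationalUnipotent n K) (unipotentTateDomain n K) ν₀ :=
    isFundamentalDomain_unipotentTateDomain ν₀
  have h𝓕c : IsCompact (closure (unipotentTateDomain n K)) := isCompact_closure_unipotentTateDomain
  have h𝓕m : MeasurableSet (unipotentTateDomain n K) := measurableSet_unipotentTateDomain
  set φ : GL (Fin n) (AdeleRing (𝓞 K) K) → ℂ :=
    invQuot (AdelicGroupData.gl n K) (smoothedForm η ((f : P.1.toSubmodule) : (AdelicGroupData.gl n K).L2 μ))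
    with hφ
  have hφc : Continuous φ := continuous_invQuot_smoothedForm hηc hηs _
  have hφinv : IsLeftInvariant (AdelicGroupData.gl n K) φ := isLeftInvariant_invQuot _ _
  set W : GL (Fin n) (AdeleRing (𝓞 K) K) → ℂ :=
    whittakerCoeff ν₀ (unipotentTateDomain n K) (adeleAddChar K) φ with hW
  have hWc : Continuous W := continuous_whittakerCoeff h𝓕m h𝓕c hψ.continuous hφc
  have hWN : ∀ u ∈ upperUnitriangular (Fin n) (AdeleRing (𝓞 K) K), ∀ g, ‖W (u * g)‖ = ‖W g‖ := by
    intro u hu g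
    have h := whittakerCoeff_unipotent_mul (ν := ν₀) (𝓕 := unipotentTateDomain n K)
      (ψ := adeleAddChar K) h𝓕 hψ hφinv ⟨u, hu⟩ g
    change W (u * g) = _ * W g at h
    rw [h, norm_mul, whittakerCharFun_apply, Circle.norm_coe, one_mul]
  obtain ⟨g₁, hg₁⟩ := exists_whittakerCoeff_invQuot_smoothedForm_ne_zero_of_one_le hn hηc hηs hcusp hne ν₀
  obtain ⟨a₁, k₀, ha₁⟩ := exists_torusPoint_apply_ne_zero hWN hg₁
  -- (3) clear the denominators of the last entry by a rational scalar
  obtain ⟨d, hd0, hdint⟩ := exists_ne_zero_valued_algebraMap_mul_le_one (K := K) (lastEntry a₁)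
  have hdK : (d : K) ≠ 0 := RingOfIntegers.coe_ne_zero_iff.mpr hd0
  set c : Kˣ := Units.mk0 (d : K) hdK with hc
  set ξ : ideleGroup K := Units.map (algebraMap K (AdeleRing (𝓞 K) K) : K →* AdeleRing (𝓞 K) K) c
    with hξ
  have hξval : ((ξ : ideleGroup K) : AdeleRing (𝓞 K) K) = algebraMap K (AdeleRing (𝓞 K) K) (d : K) := by
    rw [hξ, Units.coe_map, hc, Units.val_mk0]
    rfl
  set a₀ : Fin n → ideleGroup K := (fun _ => ξ) * a₁ with ha₀
  have ha₀W : W (torusPoint n K (a₀, k₀)) ≠ 0 := by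
    have e : W (torusPoint n K (a₀, k₀)) = W (torusPoint n K (a₁, k₀)) := by
      rw [ha₀, torusPoint_mul, hW, hξ]
      exact whittakerCoeff_glDiagonal_const_mul ν₀ _ _ hφinv c _
    rw [e]
    exact ha₁
  have hlast : lastEntry a₀ = ξ * lastEntry a₁ := by
    rw [ha₀, lastEntry_mul]
    congr 1
    unfold lastEntry
    rw [dif_pos (by omega : 0 < n)]
  have hint : ∀ w : HeightOneSpectrum (𝓞 K),
      Valued.v (((lastEntry a₀ : ideleGroup K) : AdeleRing (𝓞 K) K).2 w) ≤ 1 := by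
    intro w
    rw [hlast, Units.val_mul, hξval]
    exact hdint w
  -- (4) the exceptional set
  obtain ⟨Sψ, hSψ⟩ := exists_finset_adicComponent_adeleAddChar_unramified (K := K)
  set S₀ : Finset (HeightOneSpectrum (𝓞 K)) :=
    (Ideal.finite_factors h𝔫₀).toFinset ∪ Sψ ∪ (finite_setOf_exists_valued_ne_one a₀).toFinset with hS₀
  refine ⟨S₀, fun S α hS hα x hx σ hσ => ?_⟩
  set Good : Set (HeightOneSpectrum (𝓞 K)) := {v | v ∉ (↑S : Set (HeightOneSpectrum (𝓞 K)))} with hGooddef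
  have hgood : ∀ v ∈ Good, ¬ v.asIdeal ∣ 𝔫₀ ∧ v ∉ Sψ ∧
      ∀ i, Valued.v (((a₀ i : ideleGroup K) : AdeleRing (𝓞 K) K).2 v) = 1 := by
    intro v hv
    have hv0 : v ∉ S₀ := fun h => hv (hS h)
    simp only [hS₀, Finset.mem_union, Set.Finite.mem_toFinset, Set.mem_setOf_eq, not_or,
      not_exists, ne_eq, not_not] at hv0
    exact ⟨hv0.1.1, hv0.1.2, hv0.2⟩
  -- the enumeration extended to all places
  set x' : HeightOneSpectrum (𝓞 K) → Fin n → ℂ := fun v =>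
    if h : v ∉ (↑S : Set (HeightOneSpectrum (𝓞 K))) then x ⟨v, h⟩ else 0 with hx'def
  have hx' : ∀ (v : HeightOneSpectrum (𝓞 K)) (hv : v ∉ (↑S : Set (HeightOneSpectrum (𝓞 K)))),
      x' v = x ⟨v, hv⟩ := fun v hv => by simp only [hx'def, dif_pos hv]
  have hxGood : ∀ v ∈ Good, (Finset.univ : Finset (Fin n)).val.map (x' v) = α v := by
    intro v hv
    have hv' : v ∉ (↑S : Set (HeightOneSpectrum (𝓞 K))) := hv
    rw [hx' v hv']
    exact hx ⟨v, hv'⟩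
  have hGood : ∀ v ∈ Good, v ∉ (↑S : Set (HeightOneSpectrum (𝓞 K))) ∧ ¬ v.asIdeal ∣ 𝔫₀ ∧
      (∀ c ∈ 𝒪[v.adicCompletion K], (adeleAddChar K).adicComponent v c = 1) ∧
      ∀ ϖ : v.adicCompletion K, Valued.v ϖ = WithZero.exp (-1 : ℤ) →
        ∃ c ∈ 𝒪[v.adicCompletion K], (adeleAddChar K).adicComponent v (ϖ⁻¹ * c) ≠ 1 := by
    intro v hv
    obtain ⟨h1, h2, -⟩ := hgood v hv
    exact ⟨hv, h1, (hSψ v h2).1, (hSψ v h2).2⟩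
  have ha₀unit : a₀ ∈ unitBox Good := fun v hv i => (hgood v hv).2.2 i
  -- (5) positivity, finiteness, and the Euler lower bound
  have hposI := setLIntegral_torusIntegrand_unitBox_ne_zero hWc ha₀W ha₀unit hint hΦc hΦ σ νA νK
  have hfinI := hfin η hη _ hcusp hσ
  obtain ⟨C, hC, hbound⟩ := exists_prod_schurSelfSum_le_of_cuspidal P hα h𝔫₀ hηc hηs hηK f h𝓕 h𝓕c hψ
    hGood hxGood Φinf νA νK hfinI hposI
  refine ⟨C, hC, fun F => ?_⟩
  have hsub : (↑(F.map (Function.Embedding.subtype _)) : Set (HeightOneSpectrum (𝓞 K))) ⊆ Good := by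
    intro v hv
    rw [Finset.coe_map, Set.mem_image] at hv
    obtain ⟨w, -, rfl⟩ := hv
    exact w.2
  have h := hbound (F.map (Function.Embedding.subtype _)) hsub
  rw [Finset.prod_map] at h
  refine le_trans (le_of_eq (Finset.prod_congr rfl fun v _ => ?_)) h
  rw [Function.Embedding.coe_subtype, hx' v.1 v.2]

/-! ### The degenerate rank `n = 0` -/

/-- For `n = 0` every torus sum is `1` (`schurSelfSum_eq_ofReal_exp` with an empty family: the
exponent is an empty sum), so the partial products are bounded by `1` and
`JacquetShalika1981_schurSelfSum_prod_bounded` holds trivially in rank `0`. [folklore] -/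
theorem schurSelfSum_fin_zero (x : Fin 0 → ℂ) {t : ℝ} (ht : 0 ≤ t) : schurSelfSum x t = 1 := by
  rw [schurSelfSum_eq_ofReal_exp x ht (fun i => i.elim0)]
  simp

/-- `JacquetShalika1981_schurSelfSum_prod_bounded` in rank `0` (all torus sums are `1`). [folklore] -/
theorem JacquetShalika1981_schurSelfSum_prod_bounded_zero
    {μ₀ : Measure (AdelicGroupData.gl 0 K).automorphicQuotient}
    [(AdelicGroupData.gl 0 K).IsAutomorphicMeasure μ₀] :
    JacquetShalika1981_schurSelfSum_prod_bounded (n := 0) (K := K) (μ := μ₀) := by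
  intro P
  refine ⟨∅, fun S α _ _ x _ σ _ => ⟨1, ENNReal.one_ne_top, fun F => ?_⟩⟩
  refine le_of_eq (Finset.prod_eq_one fun v _ => schurSelfSum_fin_zero (x v) ?_)
  exact Real.rpow_nonneg (Nat.cast_nonneg _) _

end Assembly

end Literature.NumberTheory.Automorphic
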